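import Summits.QuantumFields.BalabanUV.Beta.GAN24.WSlotT2OfPieces
import Summits.QuantumFields.BalabanUV.Beta.GAN24.Push4Iter

/-!
# `BalabanUV.Beta.GAN24.T2ShapeGronwallEnd` — binder row G-an2-4 ∕ (CONV-C), CT-W (the row owner gan24-p1's «CT-W DESIGN v0» + g23's RE-CUT W3 (level form of (R-CT)): «the contact
# cell is the table defect `(𝔇 − 1) T^E_l` of the DRESSED MEMBER, its output is `ZfreeSym`, road W3's `hTirr` transports it»): THE END THAT CLOSES WHEN THE CELLS READ THE MEMBERS —
# A DISCRETE GRONWALL ∕ RENEWAL FORM OF THE OWNER's END #1 `WSlotT2OfPieces.shape_of_rows`, with the two conditions it genuinely needs DISPLAYED: rate-STABLE transport rows and the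
# smallness `CT′·κ + ρ < 1`.

NOT IN PRINT; OUR BOOKKEEPING (G-an2-4 formalisation swarm, leaf prover `b2b-balaban-gan24-formalise-leaf-03`, gen 57; offered as O-gan24leaf03-g57-2, journal `CLAIMS.log`
W-leaf03-g57-2; the row owner gan24-p1 g23's W8 ∕ RULING R-gan24p1-g23-2: «WANTED — THIS SHAPE» as the (R-GRW) SOCKET, one of two candidate closures of CT-W's crux beside
(R-DEV) `T2DeviationTower.shape_of_dev_rows`; its two letters (L1) rate stability — displayed here as ONE rate `δ` in and out — and (L2) the smallness `CT′·κ < 1 − ρ` are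
HYPOTHESES, priced by the refuter; `Zfree` ∕ `mom` ∕ the cells `c` are ABSTRACT).  HONEST FRAMING (cell contract, verbatim): «discharging `BetaPertH` makes Bałaban's UV
stability UNCONDITIONAL — a real constructive-QFT result; it is NOT the continuum limit and NOT the Clay problem.»  HONEST DEPENDENCY (verbatim): «continuum YM on T⁴ ⇐ BetaPertH ∧ nine spine
estimates (0/9 proved); BetaPertH ⇐ (D1) ∧ (D4) ∧ CAP+tail; G-an2-4 gates asym, D1 and NE2/3/4.»

WHY.  In the LEVEL form of (R-CT) (leaf-06's `lin4_comb_coDressKBmAt`, leaf-01 g62's cell split, the owner g23's W3) the dressed tower is an UNDRESSED affine tower with an extra source, the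
contact cell `c_l = 𝒜^B_l ((𝔇 − 1) T_l)` — which reads the MEMBER `T_l`.  So a row «`∀ l, LocStencil₂ (c l) Cc δ`» with a `l`-free `Cc` presupposes «T2Shape»; the END #1 with such a row as a
hypothesis (`shape_of_rows` with a third source) is an a-priori identity, not a proof.  What closes is the renewal inequality `a_n ≤ h + β·Σ_{l<n} ρ^{n−1−l}·a_l` — bounded solutions iff
`β + ρ < 1` — which needs the transport rows at a STABLE rate (output rate = input rate: the members are fed back) and the cell as a MAP of the member with a displayed norm `κ`.

WHAT ([folklore] real analysis + `LocStencil₂` bookkeeping over the owner's `WSlotT2OfPieces` §0 BY NAME; 0 `def`, 0 cited facts, 0 `def … : Prop`, 0 sorry; generic `d`):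
* §1 **`renewal_bound`**: `0 ≤ β`, `0 ≤ ρ`, `β + ρ < 1`, `0 ≤ h`, `∀ n, a n ≤ h + β·Σ_{l<n} ρ^{n−1−l}·a l` ⟹ `∀ n, a n ≤ h·(1−ρ)·(1−ρ−β)⁻¹` (strong induction; the geometric series).
* §2 **`shape_of_rows_gronwall`** — END #1, GRONWALL FORM: the owner's five row families with the transport rows `hTmarg`∕`hTirr` at ONE STABLE RATE `δ` (displayed), the split with a second level
  sum of CELLS `c i`, the cell row as a MAP `hc : LocStencil₂ (T i) C δ → LocStencil₂ (c i) (κ·C) δ ∧ mom (c i) ≤ κ·C` with `Zfree (c i)`, and the smallness `CT′·κ + ρ < 1` ⟹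
  `∀ n, LocStencil₂ (T n) ((CT·C₀ + CT′·Cb·(1−ρ)⁻¹)·(1−ρ)·(1−ρ−CT′·κ)⁻¹) δ`.  (For the owner's W3: `κ = CT′·κ_𝔇·ρ` — one `hTirr` step on the `ZfreeSym` defect already gains `ρ = Lc⁻¹` —,
  so the smallness reads `CT′²·κ_𝔇·Lc⁻¹ + Lc⁻¹ < 1`; the stable rate is the located ask (L1) of W-leaf03-g57-2.)
Asserts NO shape or rate of an2's ∕ Bałaban's tables; discharges NOTHING of «T2Shape» ∕ «T2Drift» ∕ (hW, hWall) — every row is a HYPOTHESIS; 0 wall binders; NEVER «G-an2-4 closed» as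
(CONV-C); NOT D1, NOT BetaPertH, NOT continuum, NOT Clay; not in print — our bookkeeping.
-/

noncomputable section

open Finset
open scoped BigOperators
open Literature.MathematicalPhysics.QuantumFieldTheory
open Literature.MathematicalPhysics.QuantumFieldTheory.Balaban1983to89
open Literature.MathematicalPhysics.QuantumFieldTheory.Balaban1983to89.Beta
open ExpKernelCalculus (MKer)
open OneStepResolventKernel (Fib)
open BalabanCompositeJets (LocStencil₂)
open Summit.QuantumFields.BalabanUV.Beta.GAN24.Push4Iter (BiTab)
open Summit.QuantumFields.BalabanUV.Beta.GAN24.WSlotT2OfPieces (locStencil₂_zero locStencil₂_add locStencil₂_mono locStencil₂_sum geom_reflect_sum_le)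

namespace Summit.QuantumFields.BalabanUV.Beta.GAN24.T2ShapeGronwallEnd

variable {d : ℕ}

/-! ## §1 The discrete renewal inequality with a geometric kernel -/

/-- [folklore] **DISCRETE GRONWALL ∕ RENEWAL BOUND**: if `a n ≤ h + β·Σ_{l<n} ρ^{n−1−l}·a l` for all `n`, with `0 ≤ h`, `0 ≤ β`, `0 ≤ ρ`, `β + ρ < 1`, then `a n ≤ h·(1−ρ)·(1−ρ−β)⁻¹` for
all `n` (strong induction: the bound `M` solves `h + β·M·(1−ρ)⁻¹ = M`). -/
theorem renewal_bound {a : ℕ → ℝ} {h β ρ : ℝ} (hh : 0 ≤ h) (hβ : 0 ≤ β) (hρ0 : 0 ≤ ρ) (hβρ : β + ρ < 1)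
    (ha : ∀ n, a n ≤ h + β * ∑ l ∈ Finset.range n, ρ ^ (n - 1 - l) * a l) (n : ℕ) :
    a n ≤ h * (1 - ρ) * (1 - ρ - β)⁻¹ := by
  have hρ1 : ρ < 1 := by linarith
  have h1ρ : 0 < 1 - ρ := by linarith
  have hden : 0 < 1 - ρ - β := by linarith
  set M : ℝ := h * (1 - ρ) * (1 - ρ - β)⁻¹ with hM
  have hM0 : 0 ≤ M := by positivity
  -- the fixed-point identity `h + β·M·(1−ρ)⁻¹ = M`
  have hfix : h + β * M * (1 - ρ)⁻¹ = M := by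
    rw [hM]
    field_simp
    ring
  induction n using Nat.strong_induction_on with
  | _ n ih =>
    refine (ha n).trans ?_
    have hsum : ∑ l ∈ Finset.range n, ρ ^ (n - 1 - l) * a l ≤ M * (1 - ρ)⁻¹ := by
      calc ∑ l ∈ Finset.range n, ρ ^ (n - 1 - l) * a l ≤ ∑ l ∈ Finset.range n, ρ ^ (n - 1 - l) * M :=
            Finset.sum_le_sum fun l hl => mul_le_mul_of_nonneg_left (ih l (Finset.mem_range.1 hl)) (pow_nonneg hρ0 _)
        _ = (∑ l ∈ Finset.range n, ρ ^ (n - 1 - l)) * M := by rw [Finset.sum_mul]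
        _ ≤ (1 - ρ)⁻¹ * M := mul_le_mul_of_nonneg_right (geom_reflect_sum_le hρ0 hρ1 n) hM0
        _ = M * (1 - ρ)⁻¹ := mul_comm _ _
    calc h + β * ∑ l ∈ Finset.range n, ρ ^ (n - 1 - l) * a l ≤ h + β * (M * (1 - ρ)⁻¹) := by
          have := mul_le_mul_of_nonneg_left hsum hβ; linarith
      _ = M := by linear_combination hfix

/-! ## §2 END #1, Gronwall form: the cells read the members -/

/-- NOT IN PRINT; OUR BOOKKEEPING ([folklore]).  **END #1 OF ROAD «W3», GRONWALL FORM** — for the LEVEL form of the row owner's (R-CT), where the contact CELL at level `i` is a map of the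
MEMBER `T i`.  Let `T n = P 0 n (T 0) + Σ_{i<n} P (i+1) (n−1−i) (b i) + Σ_{i<n} P (i+1) (n−1−i) (c i)` (the affine recursion with sources `b i + c i` flattened).  Assume the transport is
MARGINAL (`hTmarg`, constant `CT`) and IRRELEVANT on zero-mode-free tables of bounded first moment (`hTirr`, gain `ρ^k`, constant `CT′`) AT ONE STABLE RATE `δ` (input rate = output rate —
the rows are fed back through the members), the sources are zero-mode-free with uniform shape and moment `Cb`, member `0` has shape `C₀`, and THE CELLS ARE CONTROLLED BY THE MEMBERS:
`LocStencil₂ (T i) C δ → LocStencil₂ (c i) (κ·C) δ ∧ mom (c i) ≤ κ·C`, every cell zero-mode-free.  If `CT′·κ + ρ < 1` then EVERY member is a `LocStencil₂` family with the ONE constant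
`(CT·C₀ + CT′·Cb·(1−ρ)⁻¹)·(1−ρ)·(1−ρ−CT′·κ)⁻¹` at the rate `δ`.  Proof: §1 on `a n :=` the best available constant is avoided — strong induction directly on the `LocStencil₂` statements
with the fixed point `M` of `h + CT′·κ·M·(1−ρ)⁻¹ = M`. -/
theorem shape_of_rows_gronwall (T b c : ℕ → BiTab d) (P : ℕ → ℕ → BiTab d → BiTab d) (Zfree : BiTab d → Prop) (mom : BiTab d → ℝ)
    {δ CT CT' ρ Cb C₀ κ : ℝ} (hCT : 0 ≤ CT) (hCT' : 0 ≤ CT') (hρ0 : 0 ≤ ρ) (hκ : 0 ≤ κ) (hsmall : CT' * κ + ρ < 1)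
    (hsplit : ∀ n, T n = P 0 n (T 0) + ∑ i ∈ Finset.range n, P (i + 1) (n - 1 - i) (b i) + ∑ i ∈ Finset.range n, P (i + 1) (n - 1 - i) (c i))
    (hTmarg : ∀ (m k : ℕ) (X : BiTab d) (C : ℝ), 0 ≤ C → LocStencil₂ X C δ → LocStencil₂ (P m k X) (CT * C) δ)
    (hTirr : ∀ (m k : ℕ) (X : BiTab d) (C : ℝ), 0 ≤ C → LocStencil₂ X C δ → Zfree X → mom X ≤ C → LocStencil₂ (P m k X) (CT' * C * ρ ^ k) δ)
    (hb : ∀ m, LocStencil₂ (b m) Cb δ ∧ mom (b m) ≤ Cb) (hZ : ∀ m, Zfree (b m)) (h0 : LocStencil₂ (T 0) C₀ δ)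
    (hc : ∀ (i : ℕ) (C : ℝ), 0 ≤ C → LocStencil₂ (T i) C δ → LocStencil₂ (c i) (κ * C) δ ∧ mom (c i) ≤ κ * C) (hZc : ∀ i, Zfree (c i)) (n : ℕ) :
    LocStencil₂ (T n) ((CT * C₀ + CT' * Cb * (1 - ρ)⁻¹) * (1 - ρ) * (1 - ρ - CT' * κ)⁻¹) δ := by
  have hC₀ : 0 ≤ C₀ := h0.nonneg
  have hCb : 0 ≤ Cb := (hb 0).1.nonneg
  have hρ1 : ρ < 1 := by nlinarith
  have h1ρ : 0 < 1 - ρ := by linarith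
  have hden : 0 < 1 - ρ - CT' * κ := by linarith
  set h : ℝ := CT * C₀ + CT' * Cb * (1 - ρ)⁻¹ with hh
  have hh0 : 0 ≤ h := by positivity
  set M : ℝ := h * (1 - ρ) * (1 - ρ - CT' * κ)⁻¹ with hM
  have hM0 : 0 ≤ M := by positivity
  have hfix : h + CT' * κ * M * (1 - ρ)⁻¹ = M := by
    rw [hM]
    field_simp
    ring
  show LocStencil₂ (T n) M δ
  induction n using Nat.strong_induction_on with
  | _ n ih =>
    rw [hsplit n]
    -- the three pieces
    have hP0 : LocStencil₂ (P 0 n (T 0)) (CT * C₀) δ := hTmarg 0 n (T 0) C₀ hC₀ h0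
    have hPb : LocStencil₂ (∑ i ∈ Finset.range n, P (i + 1) (n - 1 - i) (b i)) (CT' * Cb * (1 - ρ)⁻¹) δ := by
      refine locStencil₂_mono (locStencil₂_sum (Finset.range n) _ (fun i => CT' * Cb * ρ ^ (n - 1 - i))
        fun i _ => hTirr (i + 1) (n - 1 - i) (b i) Cb hCb (hb i).1 (hZ i) (hb i).2) ?_
      rw [← Finset.mul_sum]
      exact mul_le_mul_of_nonneg_left (geom_reflect_sum_le hρ0 hρ1 n) (mul_nonneg hCT' hCb)
    have hPc : LocStencil₂ (∑ i ∈ Finset.range n, P (i + 1) (n - 1 - i) (c i)) (CT' * (κ * M) * (1 - ρ)⁻¹) δ := by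
      refine locStencil₂_mono (locStencil₂_sum (Finset.range n) _ (fun i => CT' * (κ * M) * ρ ^ (n - 1 - i)) fun i hi => ?_) ?_
      · have hTi : LocStencil₂ (T i) M δ := ih i (Finset.mem_range.1 hi)
        have hci := hc i M hM0 hTi
        exact hTirr (i + 1) (n - 1 - i) (c i) (κ * M) (mul_nonneg hκ hM0) hci.1 (hZc i) hci.2
      · rw [← Finset.mul_sum]
        exact mul_le_mul_of_nonneg_left (geom_reflect_sum_le hρ0 hρ1 n) (by positivity)
    refine locStencil₂_mono (locStencil₂_add (locStencil₂_add hP0 hPb) hPc) (le_of_eq ?_)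
    linear_combination hfix - hh

end Summit.QuantumFields.BalabanUV.Beta.GAN24.T2ShapeGronwallEnd

end
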